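import Summits.MatrixMultiplication.MatrixMultiplication.Theorems.SoloInformedCarrierFamily
import Summits.MatrixMultiplication.MatrixMultiplication.Theorems.SoloInformedWeightedLaser

/-!
# Width of the door: `R̃ ≤ 3.25` on any carrier already gives `ω < 2.37`

Solo deliverable (informed mode). The doors `R̃(T) = 3 ⇒ ω = 2` (`T = T_{cw,2}`, `T_{skewcw,2}`,
`T_μ = hCarrier μ`) come from the graded laser bound `R̃(T) < ρ ⇒ ω ≤ log₂(4ρ³/27)`, which beats
the best upper bound on `ω` known in 2026 (`ω < 2.371339`,
[AlmanDuanVassilevskaWilliamsXuXuZhou2025]) as soon as `4ρ³/27 < 2^{2.371339}`, i.e. `ρ < 3.268…`.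
Kernel form with round constants: `R̃(T) ≤ 3.25 ⇒ ω < 2.37` for every carrier with an unconditional
door (`omega_lt_of_asymptoticRank_hCarrier_le`, `omega_lt_of_asymptoticRank_cwTensor_two_le`,
`omega_lt_of_asymptoticRank_skewCwTensor_one_le`); the numerical step is
`log₂(4·3.26³/27) < 2.37`, certified by comparing `100`-th powers of rationals.
-/

noncomputable section

namespace Summit.MatrixMultiplication.MatrixMultiplication.Theorems

open Literature.Computability.AlgebraicComplexity

namespace WeightedLaser

/-- The numerical inequality `log₂(4 · 3.26³ / 27) < 2.37` (`4·3.26³/27 = 5.1327… < 2^{2.37} =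
5.1693…`), proved exactly via `(4·3.26³/27)^100 < 2^237`. -/
theorem logb_two_laser_bound_lt : Real.logb 2 (4 * (3.26 : ℝ) ^ 3 / 27) < 2.37 := by
  have hx : (0 : ℝ) < 4 * (3.26 : ℝ) ^ 3 / 27 := by norm_num
  rw [Real.logb_lt_iff_lt_rpow one_lt_two hx]
  have hy : (0 : ℝ) ≤ (2 : ℝ) ^ (2.37 : ℝ) := Real.rpow_nonneg (by norm_num) _
  refine lt_of_pow_lt_pow_left₀ 100 hy ?_
  have h2 : ((2 : ℝ) ^ (2.37 : ℝ)) ^ 100 = 2 ^ 237 := by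
    rw [← Real.rpow_natCast, ← Real.rpow_mul (by norm_num : (0 : ℝ) ≤ 2),
      show (2.37 : ℝ) * ((100 : ℕ) : ℝ) = ((237 : ℕ) : ℝ) by norm_num, Real.rpow_natCast]
  rw [h2]
  norm_num

/-- **Width of the door, family version.** If some carrier `T_μ` (`μ ≠ 0`) has `R̃(T_μ) ≤ 3.25`,
then `ω < 2.37` — below every upper bound on `ω` known in 2026 (`2.371339`).
[cite: AlmanDuanVassilevskaWilliamsXuXuZhou2025] -/
theorem omega_lt_of_asymptoticRank_hCarrier_le {μ : ℂ} (hμ : μ ≠ 0)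
    (h : asymptoticRank (hCarrier μ) ≤ 3.25) : omega ℂ < 2.37 := by
  have hρ : asymptoticRank (hCarrier μ) < 3.26 := lt_of_le_of_lt h (by norm_num)
  exact (omega_le_logb_of_asymptoticRank_hCarrier_lt hμ hρ).trans_lt logb_two_laser_bound_lt

/-- **Width of the door `D1`.** `R̃(T_{cw,2}) ≤ 3.25 ⇒ ω < 2.37` (the known range is
`R̃(T_{cw,2}) ∈ [3, 3.9310]`). [cite: AlmanDuanVassilevskaWilliamsXuXuZhou2025] -/
theorem omega_lt_of_asymptoticRank_cwTensor_two_le (h : asymptoticRank (cwTensor ℂ 2) ≤ 3.25) :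
    omega ℂ < 2.37 := by
  rw [← CarrierFamily.cwShapeTensor_one_one_one] at h
  have hρ : asymptoticRank (CarrierFamily.cwShapeTensor 1 1 1) < 3.26 :=
    lt_of_le_of_lt h (by norm_num)
  exact (CarrierFamily.laserBound_cwTensor_two 3.26 hρ).trans_lt logb_two_laser_bound_lt

/-- **Width of the skew door.** `R̃(T_{skewcw,2}) ≤ 3.25 ⇒ ω < 2.37` (known range `[3, √17]`).
[cite: AlmanDuanVassilevskaWilliamsXuXuZhou2025] -/
theorem omega_lt_of_asymptoticRank_skewCwTensor_one_le
    (h : asymptoticRank (skewCwTensor ℂ 1) ≤ 3.25) : omega ℂ < 2.37 := by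
  rw [← CarrierFamily.cwShapeTensor_one_one_skewBlock] at h
  have hρ : asymptoticRank (CarrierFamily.cwShapeTensor 1 1 CarrierFamily.skewBlock) < 3.26 :=
    lt_of_le_of_lt h (by norm_num)
  exact (CarrierFamily.laserBound_skewCwTensor_one 3.26 hρ).trans_lt logb_two_laser_bound_lt

end WeightedLaser

end Summit.MatrixMultiplication.MatrixMultiplication.Theorems

end
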